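import Literature.NumberTheory.LFunctions.DirichletLTruncationCertificatesOdd
import HarnessLib

/-!
# No real zero for the ODD real primitive characters of conductor `851 ≤ q ≤ 900`, in the kernel
# (truncation certificates with drift)

Topic `Literature/NumberTheory/LFunctions`; namespace `Literature.NumberTheory.LFunctions`
(private per-modulus work in `Literature.NumberTheory.LFunctions.OddTruncationIIIb`). THEOREMS only (no
definition, no named fact, no `sorry`): **`noRealZeroOdd_range_851_900`** — for every modulus
`851 ≤ q ≤ 900`, every primitive quadratic ODD `χ` mod `q` (imaginary quadratic fields of discriminant `−q`)
and every `σ ∈ (0, 1)`, `L(σ, χ) ≠ 0`.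

Per modulus (one bullet each, in the order of `interval_cases`): moduli without a primitive quadratic
character are dismissed (`q ≡ 2 (mod 4)`, `16 ∣ q`, `p² ∣ q` — MV Thm 9.13); the EVEN primitive quadratic
character is excluded by the parity test inside `LTruncationCert.good_odd_of_*`; the ODD one is certified by
**`LTruncationCert.certDriftOK v q K J P`** (`DirichletLTruncationCertificatesOdd.lean`): the truncation
`∑_{n ≤ Kq} χ(n) n^{−σ}` after `K` periods dominates the one-sided second-order tail bound `B⁻/(2(Kq+1)^{3/2})`
(`B⁻ = max_N (−U(N))⁺`; the drift `U(q) = q·h(−q) > 0` only helps) on each of `J` cells covering `[1/2, 1]`,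
and the functional equation reflects `(0, 1/2)` to `(1/2, 1)`.  15 certificates in this file (parameters
and margins in the docstrings; `K > 1` / `J > 16` only where the one-period truncation is too small at
`σ = 1/2`). [cite: Chua2005RealZeros, §2.2 ALGO 1]

## References

* K. S. Chua, *Real zeros of Dedekind zeta functions of real quadratic fields*, Math. Comp. 74 (2005)
  1457–1470, §2. [Chua2005RealZeros]
* M. Watkins, *Real zeros of real odd Dirichlet L-functions*, Math. Comp. 73 (2004) 415–423.
  [Watkins2004RealZeros]
* H. L. Montgomery, R. C. Vaughan, *Multiplicative Number Theory I*, CUP 2007, §9.3 Thm 9.13, §10.1.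
  [MontgomeryVaughan2007]
-/

namespace Literature.NumberTheory.LFunctions

namespace OddTruncationIIIb

open FeketePolyaKernel PrimitiveQuadratic LTruncationCert

/-- Conductor `≡ 2 (mod 4)`: no primitive character (private copy of the sweep-4 lemma).
[cite: MontgomeryVaughan2007, §9.3 Theorem 9.13] -/
private theorem absurd_of_mod_four_two {q : ℕ} [NeZero q] (hq : q % 4 = 2)
    {χ : DirichletCharacter ℂ q} (hprim : χ.IsPrimitive) : False := by
  obtain ⟨m, rfl⟩ : ∃ m, q = 2 * m := ⟨q / 2, by omega⟩
  haveI : NeZero m := ⟨by omega⟩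
  exact not_isPrimitive_two_mul (m := m) (Nat.odd_iff.mpr (by omega)) hprim

/-- Conductor divisible by `16`: no primitive quadratic character (private copy).
[cite: MontgomeryVaughan2007, §9.3 Theorem 9.13] -/
private theorem absurd_of_sixteen_dvd {q : ℕ} [NeZero q] (hq : q % 16 = 0) {χ : DirichletCharacter ℂ q}
    (hprim : χ.IsPrimitive) (hquad : χ.IsQuadratic) : False := by
  obtain ⟨k, m, hm, rfl⟩ := Nat.exists_eq_two_pow_mul_odd (NeZero.ne q)
  have hm2 := Nat.odd_iff.mp hm
  haveI : NeZero m := ⟨by omega⟩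
  have hk := le_three_of_level_two_pow_mul hm hprim hquad
  interval_cases k <;> norm_num at hq <;> omega

/-- Conductor with an odd square factor `p²`: no primitive quadratic character (private copy).
[cite: MontgomeryVaughan2007, §9.3 Theorem 9.13] -/
private theorem absurd_of_sq_dvd {q : ℕ} [NeZero q] {p : ℕ} (hp : p.Prime) (hp2 : p ≠ 2)
    (hpq : p * p ∣ q) {χ : DirichletCharacter ℂ q} (hprim : χ.IsPrimitive) (hquad : χ.IsQuadratic) :
    False := by
  obtain ⟨k, m, hm, rfl⟩ := Nat.exists_eq_two_pow_mul_odd (NeZero.ne q)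
  have hm2 := Nat.odd_iff.mp hm
  haveI : NeZero m := ⟨by omega⟩
  have hsq := squarefree_of_level_two_pow_mul hm hprim hquad
  have hp2' : Nat.Coprime p 2 := (Nat.coprime_primes hp Nat.prime_two).mpr hp2
  have hcop : Nat.Coprime (p * p) (2 ^ k) := Nat.Coprime.pow_right k (Nat.Coprime.mul_left hp2' hp2')
  have hpm : p * p ∣ m := hcop.dvd_of_dvd_mul_left hpq
  exact hp.one_lt.ne' (Nat.isUnit_iff.mp (hsq p hpm))

/-- `851`: the odd character `(·/851)` = `χ_{−851}` — drift certificate `K = 1`, `J = 16`, `P = 32` (`B⁻ = 0`, worst cell margin `0.878`). [cite: Chua2005RealZeros, §2.2 ALGO 1] -/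
private theorem goodOdd851 :
    ∀ χ : DirichletCharacter ℂ 851, χ.IsQuadratic → χ.IsPrimitive → χ.Odd →
      ∀ σ : ℝ, 0 < σ → σ < 1 → χ.LFunction σ ≠ 0 :=
  good_odd_of_odd (by decide) (by decide) 1 16 32 (by decide +kernel)

/-- `852 = 4·213`: the odd character `χ₋₄·(·/213)` = `χ_{−852}` — drift certificate `K = 1`, `J = 16`, `P = 32` (`B⁻ = 76`, worst cell margin `0.681`). [cite: Chua2005RealZeros, §2.2 ALGO 1] -/
private theorem goodOdd852 :
    ∀ χ : DirichletCharacter ℂ 852, χ.IsQuadratic → χ.IsPrimitive → χ.Odd →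
      ∀ σ : ℝ, 0 < σ → σ < 1 → χ.LFunction σ ≠ 0 :=
  good_odd_of_four (by decide) (by decide) 1 16 32 (by decide +kernel)

/-- `856 = 8·107`: the odd character `χ₈·(·/107)` = `χ_{−856}` — drift certificate `K = 1`, `J = 16`, `P = 32` (`B⁻ = 270`, worst cell margin `0.392`); the other primitive quadratic character mod `856` is even (parity test). [cite: Chua2005RealZeros, §2.2 ALGO 1] -/
private theorem goodOdd856 :
    ∀ χ : DirichletCharacter ℂ 856, χ.IsQuadratic → χ.IsPrimitive → χ.Odd →
      ∀ σ : ℝ, 0 < σ → σ < 1 → χ.LFunction σ ≠ 0 :=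
  good_odd_of_eight (by decide) (by decide) 1 16 32 (by decide +kernel) (by decide +kernel)

/-- `859`: the odd character `(·/859)` = `χ_{−859}` — drift certificate `K = 1`, `J = 16`, `P = 32` (`B⁻ = 0`, worst cell margin `0.608`). [cite: Chua2005RealZeros, §2.2 ALGO 1] -/
private theorem goodOdd859 :
    ∀ χ : DirichletCharacter ℂ 859, χ.IsQuadratic → χ.IsPrimitive → χ.Odd →
      ∀ σ : ℝ, 0 < σ → σ < 1 → χ.LFunction σ ≠ 0 :=
  good_odd_of_odd (by decide) (by decide) 1 16 32 (by decide +kernel)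

/-- `863`: the odd character `(·/863)` = `χ_{−863}` — drift certificate `K = 1`, `J = 16`, `P = 32` (`B⁻ = 0`, worst cell margin `1.848`). [cite: Chua2005RealZeros, §2.2 ALGO 1] -/
private theorem goodOdd863 :
    ∀ χ : DirichletCharacter ℂ 863, χ.IsQuadratic → χ.IsPrimitive → χ.Odd →
      ∀ σ : ℝ, 0 < σ → σ < 1 → χ.LFunction σ ≠ 0 :=
  good_odd_of_odd (by decide) (by decide) 1 16 32 (by decide +kernel)

/-- `868 = 4·217`: the odd character `χ₋₄·(·/217)` = `χ_{−868}` — drift certificate `K = 1`, `J = 16`, `P = 32` (`B⁻ = 20`, worst cell margin `0.689`). [cite: Chua2005RealZeros, §2.2 ALGO 1] -/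
private theorem goodOdd868 :
    ∀ χ : DirichletCharacter ℂ 868, χ.IsQuadratic → χ.IsPrimitive → χ.Odd →
      ∀ σ : ℝ, 0 < σ → σ < 1 → χ.LFunction σ ≠ 0 :=
  good_odd_of_four (by decide) (by decide) 1 16 32 (by decide +kernel)

/-- `871`: the odd character `(·/871)` = `χ_{−871}` — drift certificate `K = 1`, `J = 16`, `P = 32` (`B⁻ = 0`, worst cell margin `1.944`). [cite: Chua2005RealZeros, §2.2 ALGO 1] -/
private theorem goodOdd871 :
    ∀ χ : DirichletCharacter ℂ 871, χ.IsQuadratic → χ.IsPrimitive → χ.Odd →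
      ∀ σ : ℝ, 0 < σ → σ < 1 → χ.LFunction σ ≠ 0 :=
  good_odd_of_odd (by decide) (by decide) 1 16 32 (by decide +kernel)

/-- `872 = 8·109`: the odd character `χ₋₈·(·/109)` = `χ_{−872}` — drift certificate `K = 1`, `J = 16`, `P = 32` (`B⁻ = 64`, worst cell margin `0.853`); the other primitive quadratic character mod `872` is even (parity test). [cite: Chua2005RealZeros, §2.2 ALGO 1] -/
private theorem goodOdd872 :
    ∀ χ : DirichletCharacter ℂ 872, χ.IsQuadratic → χ.IsPrimitive → χ.Odd →
      ∀ σ : ℝ, 0 < σ → σ < 1 → χ.LFunction σ ≠ 0 :=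
  good_odd_of_eight (by decide) (by decide) 1 16 32 (by decide +kernel) (by decide +kernel)

/-- `879`: the odd character `(·/879)` = `χ_{−879}` — drift certificate `K = 1`, `J = 16`, `P = 32` (`B⁻ = 0`, worst cell margin `1.926`). [cite: Chua2005RealZeros, §2.2 ALGO 1] -/
private theorem goodOdd879 :
    ∀ χ : DirichletCharacter ℂ 879, χ.IsQuadratic → χ.IsPrimitive → χ.Odd →
      ∀ σ : ℝ, 0 < σ → σ < 1 → χ.LFunction σ ≠ 0 :=
  good_odd_of_odd (by decide) (by decide) 1 16 32 (by decide +kernel)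

/-- `883`: the odd character `(·/883)` = `χ_{−883}` — drift certificate `K = 1`, `J = 16`, `P = 32` (`B⁻ = 836`, worst cell margin `0.019`). [cite: Chua2005RealZeros, §2.2 ALGO 1] -/
private theorem goodOdd883 :
    ∀ χ : DirichletCharacter ℂ 883, χ.IsQuadratic → χ.IsPrimitive → χ.Odd →
      ∀ σ : ℝ, 0 < σ → σ < 1 → χ.LFunction σ ≠ 0 :=
  good_odd_of_odd (by decide) (by decide) 1 16 32 (by decide +kernel)

/-- `884 = 4·221`: the odd character `χ₋₄·(·/221)` = `χ_{−884}` — drift certificate `K = 1`, `J = 16`, `P = 32` (`B⁻ = 0`, worst cell margin `1.389`). [cite: Chua2005RealZeros, §2.2 ALGO 1] -/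
private theorem goodOdd884 :
    ∀ χ : DirichletCharacter ℂ 884, χ.IsQuadratic → χ.IsPrimitive → χ.Odd →
      ∀ σ : ℝ, 0 < σ → σ < 1 → χ.LFunction σ ≠ 0 :=
  good_odd_of_four (by decide) (by decide) 1 16 32 (by decide +kernel)

/-- `887`: the odd character `(·/887)` = `χ_{−887}` — drift certificate `K = 1`, `J = 16`, `P = 32` (`B⁻ = 0`, worst cell margin `2.546`). [cite: Chua2005RealZeros, §2.2 ALGO 1] -/
private theorem goodOdd887 :
    ∀ χ : DirichletCharacter ℂ 887, χ.IsQuadratic → χ.IsPrimitive → χ.Odd →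
      ∀ σ : ℝ, 0 < σ → σ < 1 → χ.LFunction σ ≠ 0 :=
  good_odd_of_odd (by decide) (by decide) 1 16 32 (by decide +kernel)

/-- `888 = 8·111`: the odd character `χ₈·(·/111)` = `χ_{−888}` — drift certificate `K = 1`, `J = 16`, `P = 32` (`B⁻ = 0`, worst cell margin `1.035`); the other primitive quadratic character mod `888` is even (parity test). [cite: Chua2005RealZeros, §2.2 ALGO 1] -/
private theorem goodOdd888 :
    ∀ χ : DirichletCharacter ℂ 888, χ.IsQuadratic → χ.IsPrimitive → χ.Odd →
      ∀ σ : ℝ, 0 < σ → σ < 1 → χ.LFunction σ ≠ 0 :=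
  good_odd_of_eight (by decide) (by decide) 1 16 32 (by decide +kernel) (by decide +kernel)

/-- `895`: the odd character `(·/895)` = `χ_{−895}` — drift certificate `K = 1`, `J = 16`, `P = 32` (`B⁻ = 0`, worst cell margin `1.375`). [cite: Chua2005RealZeros, §2.2 ALGO 1] -/
private theorem goodOdd895 :
    ∀ χ : DirichletCharacter ℂ 895, χ.IsQuadratic → χ.IsPrimitive → χ.Odd →
      ∀ σ : ℝ, 0 < σ → σ < 1 → χ.LFunction σ ≠ 0 :=
  good_odd_of_odd (by decide) (by decide) 1 16 32 (by decide +kernel)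

/-- `899`: the odd character `(·/899)` = `χ_{−899}` — drift certificate `K = 1`, `J = 16`, `P = 32` (`B⁻ = 0`, worst cell margin `1.210`). [cite: Chua2005RealZeros, §2.2 ALGO 1] -/
private theorem goodOdd899 :
    ∀ χ : DirichletCharacter ℂ 899, χ.IsQuadratic → χ.IsPrimitive → χ.Odd →
      ∀ σ : ℝ, 0 < σ → σ < 1 → χ.LFunction σ ≠ 0 :=
  good_odd_of_odd (by decide) (by decide) 1 16 32 (by decide +kernel)

/-- **No real zero in `(0, 1)` for every odd real primitive character of conductor `851 ≤ q ≤ 900`**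
(one bullet per modulus, in the order of `interval_cases`). [cite: Chua2005RealZeros, §2.2 ALGO 1] -/
theorem range_851_900 (q : ℕ) [NeZero q] (hlo : 850 < q) (hhi : q ≤ 900) :
    ∀ χ : DirichletCharacter ℂ q, χ.IsQuadratic → χ.IsPrimitive → χ.Odd →
      ∀ σ : ℝ, 0 < σ → σ < 1 → χ.LFunction σ ≠ 0 := by
  interval_cases q
  · exact goodOdd851 -- certificate
  · exact goodOdd852 -- certificate
  · -- 853 ≡ 1 (mod 4): the primitive quadratic character (·/853) is even (parity test)
    exact good_odd_of_odd (by decide) (by decide) 1 16 32 (by decide +kernel)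
  · -- 854 ≡ 2 (mod 4): no primitive character
    exact fun χ _ hprim _ ↦ (absurd_of_mod_four_two (by decide) hprim).elim
  · -- 3² ∣ 855: no primitive quadratic character
    exact fun χ hquad hprim _ ↦
      (absurd_of_sq_dvd (p := 3) (by norm_num) (by decide) (by decide) hprim hquad).elim
  · exact goodOdd856 -- certificate
  · -- 857 ≡ 1 (mod 4): the primitive quadratic character (·/857) is even (parity test)
    exact good_odd_of_odd (by decide) (by decide) 1 16 32 (by decide +kernel)
  · -- 858 ≡ 2 (mod 4): no primitive character
    exact fun χ _ hprim _ ↦ (absurd_of_mod_four_two (by decide) hprim).elim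
  · exact goodOdd859 -- certificate
  · -- 860 = 4·215, 215 ≡ 3 (mod 4): the primitive quadratic character is even (parity test)
    exact good_odd_of_four (by decide) (by decide) 1 16 32 (by decide +kernel)
  · -- 861 ≡ 1 (mod 4): the primitive quadratic character (·/861) is even (parity test)
    exact good_odd_of_odd (by decide) (by decide) 1 16 32 (by decide +kernel)
  · -- 862 ≡ 2 (mod 4): no primitive character
    exact fun χ _ hprim _ ↦ (absurd_of_mod_four_two (by decide) hprim).elim
  · exact goodOdd863 -- certificate
  · -- 16 ∣ 864: no primitive quadratic character
    exact fun χ hquad hprim _ ↦ (absurd_of_sixteen_dvd (by decide) hprim hquad).elim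
  · -- 865 ≡ 1 (mod 4): the primitive quadratic character (·/865) is even (parity test)
    exact good_odd_of_odd (by decide) (by decide) 1 16 32 (by decide +kernel)
  · -- 866 ≡ 2 (mod 4): no primitive character
    exact fun χ _ hprim _ ↦ (absurd_of_mod_four_two (by decide) hprim).elim
  · -- 17² ∣ 867: no primitive quadratic character
    exact fun χ hquad hprim _ ↦
      (absurd_of_sq_dvd (p := 17) (by norm_num) (by decide) (by decide) hprim hquad).elim
  · exact goodOdd868 -- certificate
  · -- 869 ≡ 1 (mod 4): the primitive quadratic character (·/869) is even (parity test)
    exact good_odd_of_odd (by decide) (by decide) 1 16 32 (by decide +kernel)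
  · -- 870 ≡ 2 (mod 4): no primitive character
    exact fun χ _ hprim _ ↦ (absurd_of_mod_four_two (by decide) hprim).elim
  · exact goodOdd871 -- certificate
  · exact goodOdd872 -- certificate
  · -- 3² ∣ 873: no primitive quadratic character
    exact fun χ hquad hprim _ ↦
      (absurd_of_sq_dvd (p := 3) (by norm_num) (by decide) (by decide) hprim hquad).elim
  · -- 874 ≡ 2 (mod 4): no primitive character
    exact fun χ _ hprim _ ↦ (absurd_of_mod_four_two (by decide) hprim).elim
  · -- 5² ∣ 875: no primitive quadratic character
    exact fun χ hquad hprim _ ↦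
      (absurd_of_sq_dvd (p := 5) (by norm_num) (by decide) (by decide) hprim hquad).elim
  · -- 876 = 4·219, 219 ≡ 3 (mod 4): the primitive quadratic character is even (parity test)
    exact good_odd_of_four (by decide) (by decide) 1 16 32 (by decide +kernel)
  · -- 877 ≡ 1 (mod 4): the primitive quadratic character (·/877) is even (parity test)
    exact good_odd_of_odd (by decide) (by decide) 1 16 32 (by decide +kernel)
  · -- 878 ≡ 2 (mod 4): no primitive character
    exact fun χ _ hprim _ ↦ (absurd_of_mod_four_two (by decide) hprim).elim
  · exact goodOdd879 -- certificate
  · -- 16 ∣ 880: no primitive quadratic character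
    exact fun χ hquad hprim _ ↦ (absurd_of_sixteen_dvd (by decide) hprim hquad).elim
  · -- 881 ≡ 1 (mod 4): the primitive quadratic character (·/881) is even (parity test)
    exact good_odd_of_odd (by decide) (by decide) 1 16 32 (by decide +kernel)
  · -- 882 ≡ 2 (mod 4): no primitive character
    exact fun χ _ hprim _ ↦ (absurd_of_mod_four_two (by decide) hprim).elim
  · exact goodOdd883 -- certificate
  · exact goodOdd884 -- certificate
  · -- 885 ≡ 1 (mod 4): the primitive quadratic character (·/885) is even (parity test)
    exact good_odd_of_odd (by decide) (by decide) 1 16 32 (by decide +kernel)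
  · -- 886 ≡ 2 (mod 4): no primitive character
    exact fun χ _ hprim _ ↦ (absurd_of_mod_four_two (by decide) hprim).elim
  · exact goodOdd887 -- certificate
  · exact goodOdd888 -- certificate
  · -- 889 ≡ 1 (mod 4): the primitive quadratic character (·/889) is even (parity test)
    exact good_odd_of_odd (by decide) (by decide) 1 16 32 (by decide +kernel)
  · -- 890 ≡ 2 (mod 4): no primitive character
    exact fun χ _ hprim _ ↦ (absurd_of_mod_four_two (by decide) hprim).elim
  · -- 3² ∣ 891: no primitive quadratic character
    exact fun χ hquad hprim _ ↦
      (absurd_of_sq_dvd (p := 3) (by norm_num) (by decide) (by decide) hprim hquad).elim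
  · -- 892 = 4·223, 223 ≡ 3 (mod 4): the primitive quadratic character is even (parity test)
    exact good_odd_of_four (by decide) (by decide) 1 16 32 (by decide +kernel)
  · -- 893 ≡ 1 (mod 4): the primitive quadratic character (·/893) is even (parity test)
    exact good_odd_of_odd (by decide) (by decide) 1 16 32 (by decide +kernel)
  · -- 894 ≡ 2 (mod 4): no primitive character
    exact fun χ _ hprim _ ↦ (absurd_of_mod_four_two (by decide) hprim).elim
  · exact goodOdd895 -- certificate
  · -- 16 ∣ 896: no primitive quadratic character
    exact fun χ hquad hprim _ ↦ (absurd_of_sixteen_dvd (by decide) hprim hquad).elim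
  · -- 897 ≡ 1 (mod 4): the primitive quadratic character (·/897) is even (parity test)
    exact good_odd_of_odd (by decide) (by decide) 1 16 32 (by decide +kernel)
  · -- 898 ≡ 2 (mod 4): no primitive character
    exact fun χ _ hprim _ ↦ (absurd_of_mod_four_two (by decide) hprim).elim
  · exact goodOdd899 -- certificate
  · -- 3² ∣ 900: no primitive quadratic character
    exact fun χ hquad hprim _ ↦
      (absurd_of_sq_dvd (p := 3) (by norm_num) (by decide) (by decide) hprim hquad).elim

end OddTruncationIIIb

open OddTruncationIIIb in
/-- **Odd real primitive characters of conductor `851 ≤ q ≤ 900` have no real zero in `(0, 1)`.**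
[cite: Watkins2004RealZeros, main theorem (d ≤ 3·10⁸, here re-proved in the kernel for this range)] -/
theorem noRealZeroOdd_range_851_900 (q : ℕ) [NeZero q] (hlo : 850 < q) (hhi : q ≤ 900) :
    ∀ χ : DirichletCharacter ℂ q, χ.IsQuadratic → χ.IsPrimitive → χ.Odd →
      ∀ σ : ℝ, 0 < σ → σ < 1 → χ.LFunction σ ≠ 0 :=
  range_851_900 q hlo hhi

end Literature.NumberTheory.LFunctions
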